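import Summits.KontsevichZagierPeriods.KontsevichZagierPeriods.Statement
import Summits.KontsevichZagierPeriods.KontsevichZagierPeriods.Theorems.TorsionLogsNeronTorsionFlexTorsionValue
import Summits.KontsevichZagierPeriods.KontsevichZagierPeriods.Theorems.TorsionLogsNeronTorsionSector

/-!
# The Néron–torsion chain with pinned carrier: the rung of line `NeronHeight` holds outright

Crux `TorsionLogs.NeronTorsionFlex` (stmt-KontsevichZagierPeriods-13806), registered line `NeronHeight`
(`Cruxes/NeronTorsionFlex/Lines/NeronHeight.lean`, stubs `stub_neronTorsionHeightChain` (the RUNG, L) and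
`stub_flexTorsionData` (M), composition `NeronTorsionFlex_of` proved there).  The rung
`NeronTorsionHeightChain` is the PROVED floor `NeronTorsionPrimitiveChain`
(`Cruxes.NeronTorsionSector.Translation.stub_assembly`: for a real `N`-torsion point `P` of the identity
component of `y² = 4x³ − g₂x − g₃` there are `c ∈ ℤ`, an algebraic `B > 1` and the log carrier
`rB = ∫_1^B dt/t` with `q²•[rI] + p²•[rP] − c•[rB] ∈ KZ.relations`) with the carrier PINNED:
`4N(N−2)·c·log B = q²·(4·log|ψ_{N−1}(x_P, y_P/2)| − N(N−2)·log(3e₁² − g₂/4))`.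

The line's on-path workfile `Lines/NeronHeight_onpath.lean` proved `value identity → rung`; the value
identity is now the theorem `TorsionLogs.NeronHeight.neronTorsion_value_identity`
(`TorsionLogsNeronTorsionFlexTorsionValue.lean`).  Hence, Theorems-side and by the same eight lines
(floor + KZ soundness `relations_le_ker_eval_holds` + `logRep_value` + the tie `q(N−2a) = 2Np`):

* `neronTorsion_height_chain` — **the rung's statement holds** (verbatim the body of
  `Cruxes.NeronTorsionFlex.NeronHeight.NeronTorsionHeightChain`; it closes the registered stub
  `stub_neronTorsionHeightChain` by `exact neronTorsion_height_chain` inside the skeleton);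
* `neronTorsionHeightChain_of_kontsevichZagierPeriods` — the forward discipline's F4 on-path lemma
  `KontsevichZagierPeriods → rung` (body form), UNCONDITIONAL; the summit hypothesis is idle because the
  rung is a theorem.  Theorems files cannot import crux workfiles, so the by-name form lives in
  `TorsionLogsNeronTorsionFlexDefs.lean` (`NeronTorsionHeightRung`, definitionally the crux constant).

[Silverman 1994 (ATAEC) Thm VI.1.1, VI.3.2; Kontsevich–Zagier 2001 §1.2]

prover-fwd2-land-3-g8-0 (on-path lander, gen 8), 2026-08-19.
-/

-- single-conjunct summit: Sub = Summit, so the namespace segment repeats by design (CONVENTIONS §2)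
set_option linter.dupNamespace false

namespace Summit.KontsevichZagierPeriods.KontsevichZagierPeriods.TorsionLogs.NeronHeight

open Literature.NumberTheory.Transcendental
open Summit.KontsevichZagierPeriods.KontsevichZagierPeriods.Cruxes.NeronTorsionSector.Translation
  (stub_assembly logRep_value)

/-- **The Néron–torsion chain computes the archimedean local height** (the rung
`NeronTorsionHeightChain` of line `NeronHeight`, verbatim its body, now a theorem): for every real curve
`y² = f(x) = 4x³ − g₂x − g₃` (`Δ ≠ 0`, largest root `e₁ > 0`), every real `N`-torsion point
`P = (x_P, y_P/2)`, `x_P > e₁`, with `N·∫_{x_P}^∞ dx/√f = a·Ω₀` (`N ≥ 3`, `0 < a < N/2`), coprime `p, q`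
with `q(N − 2a) = 2Np`, and the representations `rI`, `rP` of the floor, there are `c ∈ ℤ`, an
algebraic `B > 1` and `rB = ∫_1^B dt/t` with `q²•[rI] + p²•[rP] − c•[rB] ∈ KZ.relations` AND
`4N(N−2)·c·log B = q²·(4·log|ψ_{N−1}(x_P, y_P/2)| − N(N−2)·log(3e₁² − g₂/4))`.
Proof: the floor `stub_assembly` gives the chain; KZ soundness evaluates it to
`q²·rI.value + p²·rP.value = c·log B`; the value identity `neronTorsion_value_identity` and the tie
finish. [cite: Silverman1994, Thm VI.3.2] -/
theorem neronTorsion_height_chain :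
    ∀ (g₂ g₃ e₁ xP yP : ℝ) (N a p q : ℕ) (f : ℝ → ℝ), (∀ x, f x = 4 * x ^ 3 - g₂ * x - g₃) →
    g₂ ^ 3 - 27 * g₃ ^ 2 ≠ 0 → f e₁ = 0 → 0 < e₁ → (∀ x, e₁ < x → 0 < f x) → e₁ < xP →
    yP ^ 2 = f xP → 3 ≤ N → 0 < a → 2 * a < N →
    (∀ hns : (⟨0, 0, 0, -g₂ / 4, -g₃ / 4⟩ : WeierstrassCurve ℝ).toAffine.Nonsingular xP (yP / 2),
      addOrderOf (WeierstrassCurve.Affine.Point.some xP (yP / 2) hns) = N) →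
    (N : ℝ) * (∫ x in Set.Ioi xP, (Real.sqrt (f x))⁻¹) =
      a * (2 * ∫ x in Set.Ioi e₁, (Real.sqrt (f x))⁻¹) →
    Nat.Coprime p q → (q : ℤ) * ((N : ℤ) - 2 * (a : ℤ)) = (p : ℤ) * (2 * (N : ℤ)) →
    ∀ (rI rP : KZ.IntegralRep 2),
      rI.domain = {z | e₁ < z 1 ∧ z 1 < z 0 ∧ z 0 < xP} →
      Set.EqOn rI.integrand (fun z => z 1 / (Real.sqrt (f (z 1)) * Real.sqrt (f (z 0)))) rI.domain →
      rP.domain = {z | e₁ < z 0 ∧ e₁ < z 1} →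
      Set.EqOn rP.integrand
        (fun z => (Real.sqrt (f (z 0)))⁻¹ * ((g₂ * z 1 + 2 * g₃) / (2 * (z 1) ^ 2 * Real.sqrt (f (z 1)))))
        rP.domain →
      ∃ (c : ℤ) (B : ℝ) (rB : KZ.IntegralRep 1), 1 < B ∧ IsAlgebraic ℚ B ∧
        rB.domain = {t | 1 < t 0 ∧ t 0 < B} ∧ Set.EqOn rB.integrand (fun t => (t 0)⁻¹) rB.domain ∧
        ((q : ℤ) ^ 2) • KZ.of rI + ((p : ℤ) ^ 2) • KZ.of rP - c • KZ.of rB ∈ KZ.relations ∧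
        4 * (N : ℝ) * ((N : ℝ) - 2) * ((c : ℝ) * Real.log B) =
          (q : ℝ) ^ 2 * (4 * Real.log
              |((⟨0, 0, 0, -g₂ / 4, -g₃ / 4⟩ : WeierstrassCurve ℝ).ψ ((N : ℤ) - 1)).evalEval xP (yP / 2)|
            - (N : ℝ) * ((N : ℝ) - 2) * Real.log (3 * e₁ ^ 2 - g₂ / 4)) := by
  intro g₂ g₃ e₁ xP yP N a p q f hf hΔ hfe he₁ hpos hxP hyP hN ha haN htor hper hpq htie rI rP hIdom hIint
    hPdom hPint
  obtain ⟨c, B, rB, hB1, hBalg, hBdom, hBint, hchain⟩ :=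
    stub_assembly g₂ g₃ e₁ xP yP N a p q f hf hΔ hfe he₁ hpos hxP hyP hN ha haN htor hper hpq htie rI rP
      hIdom hIint hPdom hPint
  refine ⟨c, B, rB, hB1, hBalg, hBdom, hBint, hchain, ?_⟩
  -- KZ soundness: the chain evaluates to zero
  have hsound : (q : ℝ) ^ 2 * rI.value + (p : ℝ) ^ 2 * rP.value - c * Real.log B = 0 := by
    have h := KZ.relations_le_ker_eval_holds hchain
    rw [AddMonoidHom.mem_ker] at h
    simpa [map_add, map_sub, map_zsmul, KZ.eval_of, zsmul_eq_mul, logRep_value hB1.le rB hBdom hBint]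
      using h
  -- the value identity (theorem `neronTorsion_value_identity`)
  have hVi := neronTorsion_value_identity g₂ g₃ e₁ xP yP N a f hf hΔ hfe he₁ hpos hxP hyP hN ha haN
    htor hper rI rP hIdom hIint hPdom hPint
  have htie' : (q : ℝ) * ((N : ℝ) - 2 * a) = p * (2 * N) := by exact_mod_cast htie
  have hN0 : (N : ℝ) ≠ 0 := by
    have : (3 : ℝ) ≤ N := by exact_mod_cast hN
    linarith
  apply mul_left_cancel₀ hN0
  linear_combination (-(4 * (N : ℝ) ^ 2 * ((N : ℝ) - 2))) * hsound + ((q : ℝ) ^ 2) * hVi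
    - (((N : ℝ) - 2) * rP.value * ((q : ℝ) * ((N : ℝ) - 2 * a) + p * (2 * N))) * htie'

/-- **On-path lemma (F4) for the rung `NeronTorsionHeightChain` of line `NeronHeight`, UNCONDITIONAL**:
`KontsevichZagierPeriods →` the Néron–torsion chain with pinned carrier (conclusion VERBATIM the body of
`Cruxes.NeronTorsionFlex.NeronHeight.NeronTorsionHeightChain`).  The summit hypothesis is idle: the rung
is the theorem `neronTorsion_height_chain` (proved floor + proved value identity). [cite: Silverman1994, Thm VI.3.2] -/
theorem neronTorsionHeightChain_of_kontsevichZagierPeriods (_hS : KontsevichZagierPeriods) :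
    ∀ (g₂ g₃ e₁ xP yP : ℝ) (N a p q : ℕ) (f : ℝ → ℝ), (∀ x, f x = 4 * x ^ 3 - g₂ * x - g₃) →
    g₂ ^ 3 - 27 * g₃ ^ 2 ≠ 0 → f e₁ = 0 → 0 < e₁ → (∀ x, e₁ < x → 0 < f x) → e₁ < xP →
    yP ^ 2 = f xP → 3 ≤ N → 0 < a → 2 * a < N →
    (∀ hns : (⟨0, 0, 0, -g₂ / 4, -g₃ / 4⟩ : WeierstrassCurve ℝ).toAffine.Nonsingular xP (yP / 2),
      addOrderOf (WeierstrassCurve.Affine.Point.some xP (yP / 2) hns) = N) →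
    (N : ℝ) * (∫ x in Set.Ioi xP, (Real.sqrt (f x))⁻¹) =
      a * (2 * ∫ x in Set.Ioi e₁, (Real.sqrt (f x))⁻¹) →
    Nat.Coprime p q → (q : ℤ) * ((N : ℤ) - 2 * (a : ℤ)) = (p : ℤ) * (2 * (N : ℤ)) →
    ∀ (rI rP : KZ.IntegralRep 2),
      rI.domain = {z | e₁ < z 1 ∧ z 1 < z 0 ∧ z 0 < xP} →
      Set.EqOn rI.integrand (fun z => z 1 / (Real.sqrt (f (z 1)) * Real.sqrt (f (z 0)))) rI.domain →
      rP.domain = {z | e₁ < z 0 ∧ e₁ < z 1} →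
      Set.EqOn rP.integrand
        (fun z => (Real.sqrt (f (z 0)))⁻¹ * ((g₂ * z 1 + 2 * g₃) / (2 * (z 1) ^ 2 * Real.sqrt (f (z 1)))))
        rP.domain →
      ∃ (c : ℤ) (B : ℝ) (rB : KZ.IntegralRep 1), 1 < B ∧ IsAlgebraic ℚ B ∧
        rB.domain = {t | 1 < t 0 ∧ t 0 < B} ∧ Set.EqOn rB.integrand (fun t => (t 0)⁻¹) rB.domain ∧
        ((q : ℤ) ^ 2) • KZ.of rI + ((p : ℤ) ^ 2) • KZ.of rP - c • KZ.of rB ∈ KZ.relations ∧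
        4 * (N : ℝ) * ((N : ℝ) - 2) * ((c : ℝ) * Real.log B) =
          (q : ℝ) ^ 2 * (4 * Real.log
              |((⟨0, 0, 0, -g₂ / 4, -g₃ / 4⟩ : WeierstrassCurve ℝ).ψ ((N : ℤ) - 1)).evalEval xP (yP / 2)|
            - (N : ℝ) * ((N : ℝ) - 2) * Real.log (3 * e₁ ^ 2 - g₂ / 4)) :=
  neronTorsion_height_chain

end Summit.KontsevichZagierPeriods.KontsevichZagierPeriods.TorsionLogs.NeronHeight
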